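import Literature.Probability.Percolation.MarkedLoopTwoCellOfDarts
import Literature.Probability.Percolation.TriSandpileMarks
import HarnessLib

/-!
# The two-cell cap identity in the sandpile class («TWO-CELL-SANDPILE»): an inhabited `TwoCellDarts` from `IsPile` data

Topic `Literature/Probability/Percolation`; KhS generic-`k` marked-loop lineage, the (G0)/(G3) glue of HOME `FINDING-BSPAN-SLIDE-INDUCTION.md` §4 and
`FINDING-BSPAN-BR-SURGERY-NUMERICS.md` §5: the coordinate datum `TwoCellDarts` of `MarkedLoopTwoCellOfDarts.lean` («TWO-CELL-OF-DARTS», #1051: ★★★★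
`TwoCellDarts.lawLP_eq_twoCellCap`) is INSTANTIATED in the tame class of sandpiles (`TriSandpileOneBlock` / `TriSandpileDomain` / `TriSandpileMarks`):

* `Sandpile.TwoCellSite L P e bz S₀` — the coordinate hypotheses of the most common two-cell configuration of the class: a supported slot `e` below the pile with contact
  `{e + e₂, e + e₁}` (up-left, up-right) and free left/right neighbours, the slot `e + e₀` to its right supported as well with a free right neighbour, the cell `e + e₂ + e₃`
  present («P simple»); the observed dart `bz = (g, g + e₄)` a flat lower dart (`g + e₃`, `g + e₅` cells); the common marks `S₀` lower darts `(g', g' + e₅)` of cells with a left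
  neighbour and a free bottom, their tails off the three contact sites `e + e₂`, `e + e₁`, `e + e₀ + e₁` and their bottoms off the two slots;
* `TwoCellSite.isPile₁` / `isPile₂` — attaching `e`, then `e + e₀`, stays in the class (`IsPile.attach`);
* ★★ `TwoCellSite.twoCellDarts` — **the datum is inhabited**: `TwoCellDarts (ofSandpile P) (ofSandpile (P+e)) (ofSandpile (P+e+e')) e (e+e₀) 3 2 4 2 bz S₀` (outer run of `e`
  = `e₃ e₄ e₅`, of `e + e₀` = `e₄ e₅ e₀`; the 28 fields from the support calculus `mem_of_add_four_mem` / `mem_of_add_five_mem`, `isMarkable_lowerDart`, and lattice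
  identities);
* ★★★ `TwoCellSite.lawLP_eq_twoCellCap` — hence **THE TWO-CELL CAP IDENTITY BETWEEN SANDPILE LAWPOINTS**: with `T := S.twoCellDarts`,
  `lawLP (T.arcPointW n hn) = capInsL ℂ j⁺ (lawLP (T.slideDarts₁.arcPoint0 n hn)) + lawLP (T.arcPointPQ n hn) + lawLP (T.slideDarts₁.arcPointPQ n hn) + lawLP (T.arcPointCQ n hn)`
  — all five lawpoints are sandpile lawpoints (the four-term cap data of #887 `capInsL_mem_of_eq_four` / `bSpan_of_nested_capIns'`).

## References
* B. Bollobás, O. Riordan, *Percolation*, Cambridge University Press (2006), Ch. 7 §7.2.2 pp. 168–169 (discrete domains; marks at the second outside neighbour).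
* M. Khristoforov, S. Smirnov, *Percolation and O(1) loop model*, arXiv:2111.15612 (2021), §1.2, §2 eq. (4) and Remark 6 (arXiv v1 p. 5).
* P. A. Pearce, V. Rittenberg, J. de Gier, B. Nienhuis, *Temperley–Lieb stochastic processes*, J. Phys. A 35 (2002) L661–L668, §2 (cup–cap).

## Mathlib / tree
Tree: `MarkedLoopTwoCellOfDarts` (`TwoCellDarts`, `dartC`, `TwoCellDarts.lawLP_eq_twoCellCap`, `arcPointW/PQ/CQ`), `MarkedLoopLawSlideOfDarts` (`slideP`, `slideQ`,
`SlideDarts.arcPoint0/arcPointPQ/jIns`), `TriSandpileOneBlock` (`sandpile`, `IsPile`, `IsPile.attach`, `sandpile_insert`, `mem_of_add_four_mem`, `mem_of_add_five_mem`,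
`triDir_apply`, `triDir_sums`), `TriSandpileDomain` (`TriMarkedDomain.ofSandpile`, `ofSandpile_verts`), `TriSandpileMarks` (`isMarkable_lowerDart`), `TriDiscShelling`
(`triLeftApex_add_triDir`, `triLeftApex_add_triDir_left`, `triGraph_adj_add_triDir`), `TriDiscreteDomain` (`mem_triBdryDarts`).
-/

noncomputable section

open Finset Literature.Probability.LatticeModels

namespace Literature.Probability.Percolation

namespace Sandpile

open MarkedLoops TriMarkedDomain Literature.Probability.LatticeModels.TemperleyLieb

variable {L : ℕ} {P : Finset (Site 2)}

/-! ### The coordinate hypotheses -/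

/-- **a two-cell site of a sandpile**: the slot `e` (contact up-left/up-right only, left and right free, `e + e₂ + e₃` present), the slot `e + e₀` (its up-right present,
its right free), a flat lower observed dart `bz = (g, g + e₄)`, and common marks `S₀` = lower darts of cells with a left neighbour and a free bottom, away from the
configuration. [cite: BollobasRiordan2006, Ch. 7 §7.2.2 pp. 168–169] -/
structure TwoCellSite (L : ℕ) (P : Finset (Site 2)) (e : Site 2) (bz : Site 2 × Site 2) (S₀ : Finset (Site 2 × Site 2)) : Prop where
  /-- the slot hangs below height `0` -/
  neg : e 1 < 0
  /-- it is free -/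
  notMem : e ∉ sandpile L P
  /-- its up-left supporter -/
  ul : e + triDir 2 ∈ sandpile L P
  /-- its up-right supporter -/
  ur : e + triDir 1 ∈ sandpile L P
  /-- its left neighbour is free -/
  left : e + triDir 3 ∉ sandpile L P
  /-- its right neighbour (the second slot) is free -/
  right : e + triDir 0 ∉ sandpile L P
  /-- the second slot's up-right supporter -/
  rightUR : e + triDir 0 + triDir 1 ∈ sandpile L P
  /-- the second slot's right neighbour is free -/
  rightRight : e + triDir 0 + triDir 0 ∉ sandpile L P
  /-- «P simple»: the cell up-left of the up-left supporter -/
  simple : e + triDir 2 + triDir 3 ∈ sandpile L P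
  /-- the observed dart is a lower-left dart … -/
  bz_eq : bz.2 = bz.1 + triDir 4
  /-- … of a cell … -/
  bz_fst : bz.1 ∈ sandpile L P
  /-- … with a free bottom-left … -/
  bz_snd : bz.2 ∉ sandpile L P
  /-- … a left neighbour … -/
  bz_left : bz.1 + triDir 3 ∈ sandpile L P
  /-- … and a hanging bottom-right neighbour (a flat edge) … -/
  bz_right : bz.1 + triDir 5 ∈ sandpile L P
  /-- … whose head is neither slot -/
  bz_ne : bz.2 ≠ e ∧ bz.2 ≠ e + triDir 0
  /-- the marks are lower darts `(g, g + e₅)` of cells with a left neighbour and a free bottom -/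
  lower : ∀ d ∈ S₀, d.2 = d.1 + triDir 5 ∧ d.1 ∈ sandpile L P ∧ d.1 + triDir 3 ∈ sandpile L P ∧ d.1 + triDir 4 ∉ sandpile L P ∧ d.1 + triDir 5 ∉ sandpile L P
  /-- their bottoms avoid the two slots -/
  avoid : ∀ d ∈ S₀, d.1 + triDir 4 ≠ e ∧ d.1 + triDir 5 ≠ e ∧ d.1 + triDir 4 ≠ e + triDir 0 ∧ d.1 + triDir 5 ≠ e + triDir 0
  /-- their tails avoid the three contact sites that carry the new marks `P`, `c`, `Q` -/
  fst_ne : ∀ d ∈ S₀, d.1 ≠ e + triDir 2 ∧ d.1 ≠ e + triDir 1 ∧ d.1 ≠ e + triDir 0 + triDir 1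

namespace TwoCellSite

variable {e : Site 2} {bz : Site 2 × Site 2} {S₀ : Finset (Site 2 × Site 2)} (hP : IsPile L P) (hL : 2 ≤ L) (S : TwoCellSite L P e bz S₀)
include S

/-! ### The two attachments stay in the class -/

/-- the second slot hangs below height `0` too. [cite: BollobasRiordan2006, Ch. 7 §7.2.2 p. 168; lane plumbing] -/
theorem neg' : (e + triDir 0) 1 < 0 := by
  have := S.neg; simp only [Pi.add_apply, triDir_apply.2.1]; omega

include hP in
/-- attaching `e` gives a pile. [cite: BollobasRiordan2006, Ch. 7 §7.2.2 p. 168] -/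
theorem isPile₁ : IsPile L (insert e P) := hP.attach S.neg S.ur S.ul

include hP in
/-- attaching `e + e₀` after `e` gives a pile. [cite: BollobasRiordan2006, Ch. 7 §7.2.2 p. 168] -/
theorem isPile₂ : IsPile L (insert (e + triDir 0) (insert e P)) := by
  refine (S.isPile₁ hP).attach S.neg' ?_ ?_
  · rw [sandpile_insert]; exact Finset.mem_insert_of_mem S.rightUR
  · rw [sandpile_insert, (triDir_sums e).2.2.1]; exact Finset.mem_insert_of_mem S.ur

/-- the three site sets. [cite: BollobasRiordan2006, Ch. 7 §7.2.2 p. 168; lane plumbing] -/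
theorem verts₀₁₂ : (TriMarkedDomain.ofSandpile hP hL).verts = sandpile L P ∧ (TriMarkedDomain.ofSandpile (S.isPile₁ hP) hL).verts = insert e (sandpile L P) ∧
    (TriMarkedDomain.ofSandpile (S.isPile₂ hP) hL).verts = insert (e + triDir 0) (insert e (sandpile L P)) := by
  refine ⟨rfl, ?_, ?_⟩
  · rw [ofSandpile_verts, sandpile_insert]
  · rw [ofSandpile_verts, sandpile_insert, sandpile_insert]

/-! ### Small lattice facts -/

omit S in
/-- `Fin 6` bookkeeping of the two outer runs. [cite: BollobasRiordan2006, Ch. 7 §7.2.2 p. 168; lane plumbing] -/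
private theorem fin6 : (3 : Fin 6) + (2 + 1) = 0 ∧ (3 : Fin 6) + (2 + 5) = 4 ∧ (3 : Fin 6) + 5 = 2 ∧ (4 : Fin 6) + (2 + 1) = 1 ∧ (4 : Fin 6) + 4 = 2 ∧ (4 : Fin 6) + 1 = 5 ∧
    (4 : Fin 6) + 5 = 3 := by decide

omit S in
/-- two directions are distinct. [cite: BollobasRiordan2006, Ch. 7 §7.2.2 p. 168; lane plumbing] -/
private theorem triDir_four_ne_five : triDir 4 ≠ triDir 5 := by
  intro h; have := congrFun h 0; rw [triDir_apply.2.2.2.2.2.2.2.2.1, triDir_apply.2.2.2.2.2.2.2.2.2.2.1] at this; exact zero_ne_one this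

omit S in
/-- `e₀ ≠ 0`. [cite: BollobasRiordan2006, Ch. 7 §7.2.2 p. 168; lane plumbing] -/
private theorem add_triDir_zero_ne (x : Site 2) : x + triDir 0 ≠ x := by
  intro h; have := congrFun h 0; simp only [Pi.add_apply, triDir_apply.1] at this; omega

/-! ### The datum -/

include hP in
/-- the outer run of `e` in the pile: `e₃, e₄, e₅` free. [cite: BollobasRiordan2006, Ch. 7 §7.2.2 p. 168] -/
theorem out₁ (k : Fin 6) (hk : k ≤ 2) : e + triDir (3 + k) ∉ sandpile L P := by
  have h4 : e + triDir 4 ∉ sandpile L P := fun h => S.notMem (mem_of_add_four_mem hP S.neg.le h)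
  have h5 : e + triDir 5 ∉ sandpile L P := fun h => S.notMem (mem_of_add_five_mem hP S.neg.le h)
  have hk' : k = 0 ∨ k = 1 ∨ k = 2 := by
    rcases k with ⟨k, hk6⟩
    have : k ≤ 2 := hk
    interval_cases k <;> simp
  rcases hk' with rfl | rfl | rfl
  · simpa using S.left
  · exact (show (3 : Fin 6) + 1 = 4 by decide) ▸ h4
  · exact (show (3 : Fin 6) + 2 = 5 by decide) ▸ h5

/-- the contact arc of `e`: `e₁, e₂` present. [cite: BollobasRiordan2006, Ch. 7 §7.2.2 p. 168] -/
theorem in₁ (k : Fin 6) (hk : (2 : Fin 6) + 1 < k) : e + triDir (3 + k) ∈ sandpile L P := by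
  have hk' : k = 4 ∨ k = 5 := by
    rcases k with ⟨k, hk6⟩
    have : 3 < k := hk
    interval_cases k <;> simp
  rcases hk' with rfl | rfl
  · exact (show (3 : Fin 6) + 4 = 1 by decide) ▸ S.ur
  · exact (show (3 : Fin 6) + 5 = 2 by decide) ▸ S.ul

include hP in
/-- the outer run of `e + e₀` in the pile: `e₄, e₅, e₀` free. [cite: BollobasRiordan2006, Ch. 7 §7.2.2 p. 168] -/
theorem out₂ (k : Fin 6) (hk : k ≤ 2) : e + triDir 0 + triDir (4 + k) ∉ sandpile L P := by
  have h4 : e + triDir 0 + triDir 4 ∉ sandpile L P := fun h => S.right (mem_of_add_four_mem hP S.neg'.le h)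
  have h5 : e + triDir 0 + triDir 5 ∉ sandpile L P := fun h => S.right (mem_of_add_five_mem hP S.neg'.le h)
  have hk' : k = 0 ∨ k = 1 ∨ k = 2 := by
    rcases k with ⟨k, hk6⟩
    have : k ≤ 2 := hk
    interval_cases k <;> simp
  rcases hk' with rfl | rfl | rfl
  · simpa using h4
  · exact (show (4 : Fin 6) + 1 = 5 by decide) ▸ h5
  · exact (show (4 : Fin 6) + 2 = 0 by decide) ▸ S.rightRight

/-- the contact arc of `e + e₀` in the pile: `e₁, e₂` present (`e₃ = e` is the other new cell). [cite: BollobasRiordan2006, Ch. 7 §7.2.2 p. 168] -/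
theorem in₂ (k : Fin 6) (hk : (2 : Fin 6) < k) (hk5 : k ≠ 5) : e + triDir 0 + triDir (4 + k) ∈ sandpile L P := by
  have hk' : k = 3 ∨ k = 4 := by
    rcases k with ⟨k, hk6⟩
    have h2 : 2 < k := hk
    have h5 : k ≠ 5 := fun h => hk5 (Fin.ext h)
    interval_cases k <;> simp_all
  rcases hk' with rfl | rfl
  · exact (show (4 : Fin 6) + 3 = 1 by decide) ▸ S.rightUR
  · rw [show (4 : Fin 6) + 4 = 2 by decide, (triDir_sums e).2.2.1]; exact S.ur

/-- a mark's dart, reassembled. [cite: BollobasRiordan2006, Ch. 7 §7.2.2 p. 169; lane plumbing] -/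
theorem dart_eq {d : Site 2 × Site 2} (hd : d ∈ S₀) : d = (d.1, d.1 + triDir 5) := Prod.ext rfl (S.lower d hd).1

include hP in
/-- ★★ **THE TWO-CELL DART DATUM IS INHABITED IN THE SANDPILE CLASS.** [cite: BollobasRiordan2006, Ch. 7 §7.2.2 pp. 168–169; KhristoforovSmirnov2021, §2 Remark 6 (arXiv v1 p. 5)] -/
theorem twoCellDarts : TwoCellDarts (TriMarkedDomain.ofSandpile hP hL) (TriMarkedDomain.ofSandpile (S.isPile₁ hP) hL) (TriMarkedDomain.ofSandpile (S.isPile₂ hP) hL)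
    e (e + triDir 0) 3 2 4 2 bz S₀ where
  verts₁ := (S.verts₀₁₂ hP hL).2.1
  verts₂ := by rw [(S.verts₀₁₂ hP hL).2.2, (S.verts₀₁₂ hP hL).2.1]
  notMem₁ := S.notMem
  notMem₂ := S.right
  h₂_eq := by rw [fin6.1]
  r₂_eq := by rw [fin6.2.1]
  out₁ := S.out₁ hP
  in₁ := S.in₁
  out₂ := S.out₂ hP
  in₂ := S.in₂
  one_le₁ := by decide
  m₁_le := by decide
  one_le₂ := by decide
  m₂_le := by decide
  simpleP := by rw [fin6.2.2.1]; exact S.simple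
  bz_mem := by
    rw [mem_triBdryDarts]
    refine ⟨S.bz_fst, S.bz_snd, ?_⟩
    rw [S.bz_eq]; exact triGraph_adj_add_triDir _ _
  bz_snd := S.bz_ne
  bz_ne := by
    refine ⟨fun h => ?_, fun h => S.bz_ne.2 ?_⟩
    · -- `slideQ (e+e₀) 4 2 = (e + e₀ + e₁, e + e₀ + e₀)`: its head is not `tail + e₄`
      have h1 : bz.1 = e + triDir 0 + triDir 1 := by rw [h, slideQ, fin6.2.2.2.1]
      have h2 : bz.2 = e + triDir 0 + triDir 0 := by rw [h, slideQ, show (4 : Fin 6) + 2 = 0 by decide]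
      have h3 : bz.2 = e + triDir 0 := by rw [S.bz_eq, h1, add_assoc (e + triDir 0), add_comm (triDir 1), ← add_assoc, (triDir_sums (e + triDir 0)).1]
      exact add_triDir_zero_ne _ (h3 ▸ h2).symm
    · rw [h, dartC]
  bz_not_mem := fun h => by
    have h5 := (S.lower bz h).1
    rw [S.bz_eq] at h5
    exact triDir_four_ne_five (add_left_cancel h5)
  flat := by
    rw [S.bz_eq, triLeftApex_add_triDir, triLeftApex_add_triDir_left, fin6.2.2.2.2.2.1, fin6.2.2.2.2.2.2]
    exact ⟨S.bz_right, S.bz_left⟩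
  sub := fun d hd => by
    obtain ⟨h2, h1, -, -, h5⟩ := S.lower d hd
    obtain ⟨-, hne, -, hne'⟩ := S.avoid d hd
    refine ⟨?_, h2 ▸ hne, h2 ▸ hne'⟩
    rw [mem_triBdryDarts, h2]
    exact ⟨h1, h5, triGraph_adj_add_triDir _ _⟩
  mark := fun d hd => by
    obtain ⟨-, h1, h3, h4, h5⟩ := S.lower d hd
    rw [S.dart_eq hd]
    exact isMarkable_lowerDart h1 h3 h4 h5
  mark₁ := fun d hd => by
    obtain ⟨-, h1, h3, h4, h5⟩ := S.lower d hd
    obtain ⟨hne4, hne5, -, -⟩ := S.avoid d hd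
    rw [S.dart_eq hd, ofSandpile_verts]
    refine isMarkable_lowerDart ?_ ?_ ?_ ?_ <;> rw [sandpile_insert, Finset.mem_insert]
    · exact Or.inr h1
    · exact Or.inr h3
    · rintro (h | h); exacts [hne4 h, h4 h]
    · rintro (h | h); exacts [hne5 h, h5 h]
  mark₂ := fun d hd => by
    obtain ⟨-, h1, h3, h4, h5⟩ := S.lower d hd
    obtain ⟨hne4, hne5, hne4', hne5'⟩ := S.avoid d hd
    rw [S.dart_eq hd, ofSandpile_verts]
    refine isMarkable_lowerDart ?_ ?_ ?_ ?_ <;> rw [sandpile_insert, sandpile_insert, Finset.mem_insert, Finset.mem_insert]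
    · exact Or.inr (Or.inr h1)
    · exact Or.inr (Or.inr h3)
    · rintro (h | h | h); exacts [hne4' h, hne4 h, h4 h]
    · rintro (h | h | h); exacts [hne5' h, hne5 h, h5 h]
  inj := fun d hd d' hd' h => by
    rw [S.dart_eq hd, S.dart_eq hd']
    simp only [Finset.mem_coe] at hd hd'
    exact Prod.ext h (by simp only; rw [h])
  fst_ne := fun d hd => by
    obtain ⟨hP', hc, hQ⟩ := S.fst_ne d hd
    refine ⟨?_, ?_, ?_⟩
    · rw [slideP, fin6.2.2.1]; exact hP'
    · rw [slideQ, fin6.2.2.2.1]; exact hQ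
    · rw [dartC, fin6.2.2.2.2.1, (triDir_sums e).2.2.1]; exact hc
  dQ_not_mem := fun h => (S.fst_ne _ h).2.2 (by rw [slideQ, fin6.2.2.2.1])
  dc_not_mem := fun h => (S.fst_ne _ h).2.1 (by rw [dartC, fin6.2.2.2.2.1, (triDir_sums e).2.2.1])

include hP in
/-- ★★★ **THE TWO-CELL CAP IDENTITY BETWEEN SANDPILE LAWPOINTS**: at a two-cell site with `#S₀ = n + 1` common marks, the law of the pile with both slots filled and marked at
their first corners equals the cap insertion of the law of the pile plus the three laws of the pile marked additionally at `{P, Q}`, `{P, c}`, `{c, Q}` — every lawpoint a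
member of the class. [cite: KhristoforovSmirnov2021, §2 eq. (4) and Remark 6 (arXiv v1 p. 5); BollobasRiordan2006, Ch. 7 §7.2.2 pp. 168–169; PearceRittenbergDeGierNienhuis2002, §2] -/
theorem lawLP_eq_twoCellCap (n : ℕ) (hn : #S₀ = n + 1) :
    lawLP ((S.twoCellDarts hP hL).arcPointW n hn) =
      capInsL ℂ (Fin.castSucc ((S.twoCellDarts hP hL).slideDarts₁.jIns n hn)) (lawLP ((S.twoCellDarts hP hL).slideDarts₁.arcPoint0 n hn)) +
        lawLP ((S.twoCellDarts hP hL).arcPointPQ n hn) + lawLP ((S.twoCellDarts hP hL).slideDarts₁.arcPointPQ n hn) + lawLP ((S.twoCellDarts hP hL).arcPointCQ n hn) :=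
  (S.twoCellDarts hP hL).lawLP_eq_twoCellCap n hn

end TwoCellSite

/-! ### An explicit inhabitant: the pile `R(2,9) ∪ {(6,−1)}`, slots `(2,−1)`, `(3,−1)`, observed dart `((5,0),(5,−1))`, one mark at `((7,0),(8,−1))` -/

section Example

/-- the six directions as coordinate vectors. [cite: BollobasRiordan2006, Ch. 7 §7.2.2 p. 168; lane plumbing] -/
private theorem triDir_vec : triDir 0 = ![1, 0] ∧ triDir 1 = ![0, 1] ∧ triDir 2 = ![-1, 1] ∧ triDir 3 = ![-1, 0] ∧ triDir 4 = ![0, -1] ∧ triDir 5 = ![1, -1] := by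
  refine ⟨?_, ?_, ?_, ?_, ?_, ?_⟩ <;> (ext i; fin_cases i <;> simp [triDir])

/-- coordinatewise addition of explicit vectors. [cite: BollobasRiordan2006, Ch. 7 §7.2.2 p. 168; lane plumbing] -/
private theorem vec_add (a b c d : ℤ) : ((![a, b] : Site 2) + ![c, d]) = ![a + c, b + d] := by
  ext i; fin_cases i <;> simp

/-- membership of an explicit vector in the example pile. [cite: BollobasRiordan2006, Ch. 7 §7.2.2 p. 168; lane plumbing] -/
private theorem vec_mem (a b : ℤ) : (![a, b] : Site 2) ∈ sandpile 9 ({![6, -1]} : Finset (Site 2)) ↔ (0 ≤ a ∧ a < 9 ∧ 0 ≤ b ∧ b < 2) ∨ (a = 6 ∧ b = -1) := by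
  rw [mem_sandpile, mem_baseStrip, Finset.mem_singleton]
  simp only [Matrix.cons_val_zero, Matrix.cons_val_one, Nat.cast_ofNat]
  constructor
  · rintro (h | h)
    · exact Or.inl h
    · exact Or.inr ⟨by have := congrFun h 0; simpa using this, by have := congrFun h 1; simpa using this⟩
  · rintro (h | ⟨rfl, rfl⟩)
    · exact Or.inl h
    · exact Or.inr rfl

/-- ★ the example pile `R(2,9) ∪ {(6,−1)}` is a pile. [cite: BollobasRiordan2006, Ch. 7 §7.2.2 p. 168] -/
theorem isPile_example : IsPile 9 ({![6, -1]} : Finset (Site 2)) := by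
  have h := (IsPile.empty 9).attach (e := ![6, -1]) (by simp) ?_ ?_
  · rwa [Finset.insert_empty] at h
  · rw [triDir_vec.2.1, vec_add, mem_sandpile, mem_baseStrip]; left; simp
  · rw [triDir_vec.2.2.1, vec_add, mem_sandpile, mem_baseStrip]; left; simp

/-- ★★ **an explicit two-cell site**: slots `(2,−1)`, `(3,−1)` under `R(2,9) ∪ {(6,−1)}`, observed dart `((5,0),(5,−1))` (flat: `(4,0)` and `(6,−1)` are cells), one common mark at
the lower dart `((7,0),(8,−1))` — so `TwoCellDarts` (#1051) is inhabited (`twoCellDarts_example`). [cite: BollobasRiordan2006, Ch. 7 §7.2.2 pp. 168–169] -/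
theorem twoCellSite_example : TwoCellSite 9 ({![6, -1]} : Finset (Site 2)) ![2, -1] (![5, 0], ![5, -1]) {(![7, 0], ![8, -1])} where
  neg := by simp
  notMem := by rw [vec_mem]; norm_num
  ul := by rw [triDir_vec.2.2.1, vec_add, vec_mem]; norm_num
  ur := by rw [triDir_vec.2.1, vec_add, vec_mem]; norm_num
  left := by rw [triDir_vec.2.2.2.1, vec_add, vec_mem]; norm_num
  right := by rw [triDir_vec.1, vec_add, vec_mem]; norm_num
  rightUR := by rw [triDir_vec.1, triDir_vec.2.1, vec_add, vec_add, vec_mem]; norm_num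
  rightRight := by rw [triDir_vec.1, vec_add, vec_add, vec_mem]; norm_num
  simple := by rw [triDir_vec.2.2.1, triDir_vec.2.2.2.1, vec_add, vec_add, vec_mem]; norm_num
  bz_eq := by simp only; rw [triDir_vec.2.2.2.2.1, vec_add]; norm_num
  bz_fst := by simp only; rw [vec_mem]; norm_num
  bz_snd := by simp only; rw [vec_mem]; norm_num
  bz_left := by simp only; rw [triDir_vec.2.2.2.1, vec_add, vec_mem]; norm_num
  bz_right := by simp only; rw [triDir_vec.2.2.2.2.2, vec_add, vec_mem]; norm_num
  bz_ne := by
    simp only; rw [triDir_vec.1, vec_add]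
    exact ⟨fun h => by have := congrFun h 0; simp at this, fun h => by have := congrFun h 0; simp at this⟩
  lower := fun d hd => by
    rw [Finset.mem_singleton] at hd; subst hd; simp only
    rw [triDir_vec.2.2.2.1, triDir_vec.2.2.2.2.1, triDir_vec.2.2.2.2.2, vec_add, vec_add, vec_add, vec_mem, vec_mem, vec_mem, vec_mem]
    norm_num
  avoid := fun d hd => by
    rw [Finset.mem_singleton] at hd; subst hd; simp only
    rw [triDir_vec.1, triDir_vec.2.2.2.2.1, triDir_vec.2.2.2.2.2, vec_add, vec_add, vec_add]
    refine ⟨fun h => ?_, fun h => ?_, fun h => ?_, fun h => ?_⟩ <;> (have := congrFun h 0; simp at this)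
  fst_ne := fun d hd => by
    rw [Finset.mem_singleton] at hd; subst hd; simp only
    rw [triDir_vec.1, triDir_vec.2.1, triDir_vec.2.2.1, vec_add, vec_add, vec_add]
    refine ⟨fun h => ?_, fun h => ?_, fun h => ?_⟩ <;> (have := congrFun h 0; simp at this)

/-- ★★ **`TwoCellDarts` is inhabited**: the example site's datum (one common mark, `n = 0`). [cite: BollobasRiordan2006, Ch. 7 §7.2.2 pp. 168–169; KhristoforovSmirnov2021, §2 Remark 6 (arXiv v1 p. 5)] -/
theorem twoCellDarts_example : TwoCellDarts (TriMarkedDomain.ofSandpile isPile_example (by norm_num)) (TriMarkedDomain.ofSandpile (twoCellSite_example.isPile₁ isPile_example) (by norm_num))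
    (TriMarkedDomain.ofSandpile (twoCellSite_example.isPile₂ isPile_example) (by norm_num)) ![2, -1] (![2, -1] + triDir 0) 3 2 4 2 (![5, 0], ![5, -1]) {(![7, 0], ![8, -1])} :=
  twoCellSite_example.twoCellDarts isPile_example (by norm_num)

end Example

end Sandpile

end Literature.Probability.Percolation
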